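import Summits.NavierStokesRegularity.NavierStokesRegularity.Theorems.WakeRatchetTailTools
import Summits.NavierStokesRegularity.NavierStokesRegularity.Theorems.WakeRatchetEternalInviscidRateConveyorMassInvariant
import Summits.NavierStokesRegularity.NavierStokesRegularity.Theorems.WakeRatchetEternalInviscidRateNoSloshingOneWay

/-!
# Conveyor ledger (crux `WakeRatchet.EternalInviscidRate`, ⟨stmt-NavierStokesRegularity-25646⟩) —
# the TOTAL-FLUX IDENTITY for final tails and the reduction «no conveyor ⟸ single-shell peaks fade»

Helpers for the open stub `stub_noConveyor` of the registered skeleton «conveyor ledger» (LINE g10-3, sha16 d183ebc25b56,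
namespace `…Cruxes.EternalInviscidRate.FinalWakeLedger`).  MODEL lattice only (Tao 2016 §4 renormalised cascade); nothing here is
a statement about the Navier–Stokes equations, no stub is closed by name, no summit is proved by this file.

Setting: a uniformly bounded admissible INVISCID eternal solution `W` of a cancelling table (`IsEternal ε₀ α W`, `UniformBound W`,
`ε₀ > 0`), its physical tails `T_n(σ) = Σ_{k≥0} E_{n+k}(σ)` with final values `L n` (landed `stub_tailLimit`), final wakes `ω`
(landed `stub_wakeLimit`) and conveyor mass `m = L n − Σ_k ω (n+k)` (landed `conveyorMass`, shell-independent).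

* `integrable_physFlux` — every bond flux `F_n` is integrable on the whole log-time axis: `|F_n| ≤ 2C_AΛ⁻¹‖W_{n+1}‖E_n`
  (`abs_physFlux_le`), `E_n` is bounded by the tail envelope, and `‖W_{n+1}‖` is integrable by the ACTION clause of `IsEternal`;
  measurability because `F_n` is the derivative of the tail `T_{n+1}` (`hasDerivAt_finalTail`).
* `finalTail_eq_integral_physFlux` — **TOTAL-FLUX IDENTITY** `L (n+1) = ∫_ℝ F_n(σ) dσ`: the final tail above shell `n+1` is the total
  energy ever transferred through bond `n` (FTC on `ℝ`: `T_{n+1}' = F_n`, `T_{n+1}(−∞) = 0` from the geometric bound `tsum_le_geom`,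
  `T_{n+1}(+∞) = L(n+1)`).
* `finalTail_le_fluxConst_mul_action_mul_peak` — hence `L (n+1) ≤ 2C_AΛ⁻¹ · A · S` whenever `∫_ℝ‖W_{n+1}‖ ≤ A` and the single-shell physical
  energy obeys `E_n(σ) ≤ S` at all log-times: ACTION × SINGLE-SHELL PEAK controls everything that gets past bond `n`.
* `conveyorMass_le_of_peak` — the conveyor mass obeys `m ≤ 2C_AΛ⁻¹ · M · S` for EVERY shell `n` whose peak is `≤ S` (`M` = the
  uniform action bound of `IsEternal`); so a conveyor (`m > 0`) keeps the peak physical energy of EVERY shell above the floor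
  `mΛ/(2C_A M)` (`peak_floor_of_conveyor`).
* `noConveyor_of_peaks_fade` — **REDUCTION of `stub_noConveyor`**: if the single-shell peaks fade along SOME sequence of shells
  (`∀ δ > 0 ∃ n, ∀ σ, E_n(σ) ≤ δ` — no rate asked), then `m = 0`, i.e. `L n = Σ_k ω (n+k)` at every shell = the inner conclusion of
  `NoConveyor R`.  The residual content of `stub_noConveyor` is therefore the decay statement «`inf_n sup_σ E_n(σ) = 0` for bounded
  admissible inviscid eternal solutions of `E₂(R)` tables at small `ε₀`» — a thick front spreading thin cannot convey, only PEAKED shells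
  can (the unitary block-self-similar conveyor of `…BlockDSSNoConveyor` has constant peaks).
[cite: Tao2016AveragedNS, §4 Lemma 4.1 (4.8)–(4.10) with the cancellation (4.3), in the self-similar variables of §6.4]
-/

noncomputable section

set_option linter.dupNamespace false

open Filter Topology Set MeasureTheory
open Literature.Analysis.FluidPDE Literature.Analysis.FluidPDE.TaoCascade
open Summit.NavierStokesRegularity.NavierStokesRegularity.Theorems

namespace Summit.NavierStokesRegularity.NavierStokesRegularity.Cruxes.EternalInviscidRate.FinalWakeLedger

variable {ε₀ : ℝ} {α : Fin 4 → Fin 4 → Fin 4 → ℤ × ℤ × ℤ → ℝ} {W : ℤ → ℝ → Em 4}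

/-- Single-shell physical energies of a uniformly bounded admissible eternal solution with final tails are bounded in log-time
(by the global bound of the tail they head). -/
theorem exists_peak_bound (hε : 0 < ε₀) (hU : UniformBound W) (n : ℤ) {Ln : ℝ}
    (hL : Tendsto (fun σ => ∑' k : ℕ, physEnergy ε₀ W (n + k) σ) atTop (𝓝 Ln)) :
    ∃ S : ℝ, 0 ≤ S ∧ ∀ σ : ℝ, physEnergy ε₀ W n σ ≤ S := by
  obtain ⟨M, hM⟩ := finalTail_globally_bdd hε hU n hL
  refine ⟨max M 0, le_max_right _ _, fun σ => ?_⟩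
  exact ((WakeRatchetTail.physEnergy_le_tail hε hU n σ).trans (hM σ)).trans (le_max_left _ _)

/-- Pointwise flux bound under a single-shell peak bound: `|F_n(σ)| ≤ 2C_AΛ⁻¹ · S · ‖W_{n+1}(σ)‖`. -/
theorem abs_physFlux_le_peak (hε : 0 < ε₀) (hc : IsCancellingCoeff α) (n : ℤ) {S : ℝ}
    (hS : ∀ σ : ℝ, physEnergy ε₀ W n σ ≤ S) (σ : ℝ) :
    |physFlux ε₀ α W n σ| ≤ 2 * fluxConst α * (bigLam ε₀)⁻¹ * S * ‖W (n + 1) σ‖ := by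
  have h := abs_physFlux_le hε hc W n σ
  have hΛ : 0 < bigLam ε₀ := bigLam_pos (by linarith)
  have hc0 : 0 ≤ 2 * fluxConst α * (bigLam ε₀)⁻¹ * ‖W (n + 1) σ‖ := by
    have := fluxConst_nonneg α; positivity
  calc |physFlux ε₀ α W n σ|
      ≤ 2 * fluxConst α * (bigLam ε₀)⁻¹ * ‖W (n + 1) σ‖ * physEnergy ε₀ W n σ := h
    _ ≤ 2 * fluxConst α * (bigLam ε₀)⁻¹ * ‖W (n + 1) σ‖ * S := mul_le_mul_of_nonneg_left (hS σ) hc0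
    _ = 2 * fluxConst α * (bigLam ε₀)⁻¹ * S * ‖W (n + 1) σ‖ := by ring

/-- **Bond fluxes are integrable on the whole log-time axis** (action clause × bounded single-shell energy; measurable as the
derivative of the tail above). -/
theorem integrable_physFlux (hε : 0 < ε₀) (hc : IsCancellingCoeff α) (hW : IsEternal ε₀ α W) (hU : UniformBound W)
    (n : ℤ) {S : ℝ} (hS : ∀ σ : ℝ, physEnergy ε₀ W n σ ≤ S) :
    Integrable (physFlux ε₀ α W n) := by
  obtain ⟨M, hM⟩ := hW.action
  -- measurability: `F_n = (T_{n+1})'`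
  have hderiv : ∀ σ, HasDerivAt (fun z => ∑' k : ℕ, physEnergy ε₀ W (n + 1 + k) z) (physFlux ε₀ α W n σ) σ := by
    intro σ
    have h := hasDerivAt_finalTail hε hc hW hU (n + 1) σ
    rwa [add_sub_cancel_right] at h
  have hmeas : AEStronglyMeasurable (physFlux ε₀ α W n) volume := by
    have e : physFlux ε₀ α W n = deriv (fun z => ∑' k : ℕ, physEnergy ε₀ W (n + 1 + k) z) := by
      funext σ; exact ((hderiv σ).deriv).symm
    rw [e]
    exact (measurable_deriv _).aestronglyMeasurable
  -- domination by `c S ‖W_{n+1}‖`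
  have hg : Integrable (fun σ => 2 * fluxConst α * (bigLam ε₀)⁻¹ * S * ‖W (n + 1) σ‖) :=
    ((hM (n + 1)).1).const_mul _
  refine hg.mono' hmeas (Eventually.of_forall fun σ => ?_)
  rw [Real.norm_eq_abs]
  exact abs_physFlux_le_peak hε hc n hS σ

/-- Physical tails vanish in the far past: `T_n(σ) → 0` as `σ → −∞` (geometric bound `Λ^{-2n}e^{2σ}C²/(1−Λ⁻²)`). -/
theorem tendsto_finalTail_atBot (hε : 0 < ε₀) (hU : UniformBound W) (n : ℤ) :
    Tendsto (fun σ => ∑' k : ℕ, physEnergy ε₀ W (n + k) σ) atBot (𝓝 0) := by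
  obtain ⟨C, hC⟩ := hU
  set K : ℝ := (bigLam ε₀ ^ n)⁻¹ ^ 2 * C ^ 2 * (1 - (bigLam ε₀)⁻¹ ^ 2)⁻¹ with hK
  have hexp : Tendsto (fun σ : ℝ => Real.exp (2 * σ)) atBot (𝓝 0) :=
    Real.tendsto_exp_atBot.comp (tendsto_id.const_mul_atBot (by norm_num : (0 : ℝ) < 2))
  have hmaj : Tendsto (fun σ : ℝ => K * Real.exp (2 * σ)) atBot (𝓝 0) := by
    simpa using hexp.const_mul K
  refine squeeze_zero (fun σ => tsum_nonneg fun k => physEnergy_nonneg _ _ _ _) (fun σ => ?_) hmaj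
  calc ∑' k : ℕ, physEnergy ε₀ W (n + k) σ
      ≤ (bigLam ε₀ ^ n)⁻¹ ^ 2 * (Real.exp (2 * σ) * C ^ 2) * (1 - (bigLam ε₀)⁻¹ ^ 2)⁻¹ :=
        WakeRatchetTail.tsum_le_geom hε hC n σ
    _ = K * Real.exp (2 * σ) := by rw [hK]; ring

/-- **TOTAL-FLUX IDENTITY.**  The final tail above shell `n+1` is the total energy ever transferred through bond `n`:
`L (n+1) = ∫_ℝ F_n(σ) dσ`. -/
theorem finalTail_eq_integral_physFlux (hε : 0 < ε₀) (hc : IsCancellingCoeff α) (hW : IsEternal ε₀ α W)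
    (hU : UniformBound W) (n : ℤ) {L : ℤ → ℝ}
    (hL : ∀ n : ℤ, Tendsto (fun σ => ∑' k : ℕ, physEnergy ε₀ W (n + k) σ) atTop (𝓝 (L n))) :
    L (n + 1) = ∫ σ, physFlux ε₀ α W n σ := by
  obtain ⟨S, -, hS⟩ := exists_peak_bound hε hU n (hL n)
  have hderiv : ∀ σ, HasDerivAt (fun z => ∑' k : ℕ, physEnergy ε₀ W (n + 1 + k) z) (physFlux ε₀ α W n σ) σ := by
    intro σ
    have h := hasDerivAt_finalTail hε hc hW hU (n + 1) σ
    rwa [add_sub_cancel_right] at h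
  have h := integral_of_hasDerivAt_of_tendsto hderiv (integrable_physFlux hε hc hW hU n hS)
    (tendsto_finalTail_atBot hε hU (n + 1)) (hL (n + 1))
  rw [h, sub_zero]

/-- **Action × peak controls the final tail.**  If `∫_ℝ ‖W_{n+1}‖ ≤ A` and `E_n(σ) ≤ S` at all log-times, then
`L (n+1) ≤ 2C_AΛ⁻¹ · S · A`. -/
theorem finalTail_le_fluxConst_mul_peak_mul_action (hε : 0 < ε₀) (hc : IsCancellingCoeff α) (hW : IsEternal ε₀ α W)
    (hU : UniformBound W) (n : ℤ) {L : ℤ → ℝ}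
    (hL : ∀ n : ℤ, Tendsto (fun σ => ∑' k : ℕ, physEnergy ε₀ W (n + k) σ) atTop (𝓝 (L n)))
    {S A : ℝ} (hS : ∀ σ : ℝ, physEnergy ε₀ W n σ ≤ S) (hA : ∫ σ, ‖W (n + 1) σ‖ ≤ A) :
    L (n + 1) ≤ 2 * fluxConst α * (bigLam ε₀)⁻¹ * S * A := by
  obtain ⟨M, hM⟩ := hW.action
  have hΛ : 0 < bigLam ε₀ := bigLam_pos (by linarith)
  have hS0 : 0 ≤ S := (physEnergy_nonneg _ _ _ _).trans (hS 0)
  have hc0 : 0 ≤ 2 * fluxConst α * (bigLam ε₀)⁻¹ * S := by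
    have := fluxConst_nonneg α; positivity
  have hint : Integrable (fun σ => ‖W (n + 1) σ‖) := (hM (n + 1)).1
  rw [finalTail_eq_integral_physFlux hε hc hW hU n hL]
  calc ∫ σ, physFlux ε₀ α W n σ
      ≤ ∫ σ, 2 * fluxConst α * (bigLam ε₀)⁻¹ * S * ‖W (n + 1) σ‖ :=
        integral_mono (integrable_physFlux hε hc hW hU n hS) (hint.const_mul _)
          fun σ => (le_abs_self _).trans (abs_physFlux_le_peak hε hc n hS σ)
    _ = 2 * fluxConst α * (bigLam ε₀)⁻¹ * S * ∫ σ, ‖W (n + 1) σ‖ := integral_const_mul _ _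
    _ ≤ 2 * fluxConst α * (bigLam ε₀)⁻¹ * S * A := mul_le_mul_of_nonneg_left hA hc0

/-- **The conveyor mass is controlled by action × ANY single-shell peak.**  With `M` the uniform action bound of `IsEternal`
(`∫_ℝ ‖W_k‖ ≤ M` for every shell), every shell `n` whose physical energy stays `≤ S` gives `m ≤ 2C_AΛ⁻¹ · S · M`. -/
theorem conveyorMass_le_of_peak (hε : 0 < ε₀) (hc : IsCancellingCoeff α) (hW : IsEternal ε₀ α W) (hU : UniformBound W)
    {ω : ℤ → ℝ} (hω : ∀ k : ℤ, Tendsto (physEnergy ε₀ W k) atTop (𝓝 (ω k)))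
    {L : ℤ → ℝ} (hL : ∀ n : ℤ, Tendsto (fun σ => ∑' k : ℕ, physEnergy ε₀ W (n + k) σ) atTop (𝓝 (L n)))
    {M : ℝ} (hM : ∀ k : ℤ, ∫ σ, ‖W k σ‖ ≤ M)
    (n₀ n : ℤ) {S : ℝ} (hS : ∀ σ : ℝ, physEnergy ε₀ W n σ ≤ S) :
    conveyorMass ω L n₀ ≤ 2 * fluxConst α * (bigLam ε₀)⁻¹ * S * M := by
  have hSm : ∀ (n : ℤ) (σ : ℝ), Summable (fun k : ℕ => physEnergy ε₀ W (n + k) σ) :=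
    summable_physEnergy_tail_cm hε hU
  rw [conveyorMass_const hSm hω hL n₀ (n + 1)]
  unfold conveyorMass
  have hω0 : 0 ≤ ∑' k : ℕ, ω (n + 1 + k) := tsum_nonneg fun k => finalWake_nonneg hω _
  have h := finalTail_le_fluxConst_mul_peak_mul_action hε hc hW hU n hL hS (hM (n + 1))
  linarith

/-- **A conveyor keeps every shell's peak above a floor.**  Every level `S` with `S · 2C_AΛ⁻¹M < m` (`m` the conveyor mass,
`M` the uniform action bound) is EXCEEDED by the physical energy of EVERY shell at some log-time: a positive conveyor mass forces
`sup_σ E_n(σ) ≥ mΛ/(2C_A M)` uniformly in `n` (contrapositive of `conveyorMass_le_of_peak`). -/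
theorem peak_floor_of_conveyor (hε : 0 < ε₀) (hc : IsCancellingCoeff α) (hW : IsEternal ε₀ α W) (hU : UniformBound W)
    {ω : ℤ → ℝ} (hω : ∀ k : ℤ, Tendsto (physEnergy ε₀ W k) atTop (𝓝 (ω k)))
    {L : ℤ → ℝ} (hL : ∀ n : ℤ, Tendsto (fun σ => ∑' k : ℕ, physEnergy ε₀ W (n + k) σ) atTop (𝓝 (L n)))
    {M : ℝ} (hM : ∀ k : ℤ, ∫ σ, ‖W k σ‖ ≤ M) (n₀ n : ℤ)
    {S : ℝ} (hS : S * (2 * fluxConst α * (bigLam ε₀)⁻¹ * M) < conveyorMass ω L n₀) :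
    ∃ σ : ℝ, S < physEnergy ε₀ W n σ := by
  by_contra h
  push Not at h
  have hle := conveyorMass_le_of_peak hε hc hW hU hω hL hM n₀ n h
  linarith

/-- **REDUCTION of `stub_noConveyor`: fading single-shell peaks ⇒ no conveyor mass.**  If along SOME shells the single-shell physical
energy peaks become arbitrarily small (`∀ δ > 0, ∃ n, ∀ σ, E_n(σ) ≤ δ`; no rate is asked), then every final tail equals the sum of the
final wakes above it — the inner conclusion of `NoConveyor R`. -/
theorem noConveyor_of_peaks_fade (hε : 0 < ε₀) (hc : IsCancellingCoeff α) (hW : IsEternal ε₀ α W) (hU : UniformBound W)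
    {ω : ℤ → ℝ} (hω : ∀ k : ℤ, Tendsto (physEnergy ε₀ W k) atTop (𝓝 (ω k)))
    {L : ℤ → ℝ} (hL : ∀ n : ℤ, Tendsto (fun σ => ∑' k : ℕ, physEnergy ε₀ W (n + k) σ) atTop (𝓝 (L n)))
    (hfade : ∀ δ : ℝ, 0 < δ → ∃ n : ℤ, ∀ σ : ℝ, physEnergy ε₀ W n σ ≤ δ) (n : ℤ) :
    L n = ∑' k : ℕ, ω (n + k) := by
  obtain ⟨M, hM⟩ := hW.action
  have hSm : ∀ (n : ℤ) (σ : ℝ), Summable (fun k : ℕ => physEnergy ε₀ W (n + k) σ) :=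
    summable_physEnergy_tail_cm hε hU
  have hm0 : 0 ≤ conveyorMass ω L n := conveyorMass_nonneg hSm hω hL n
  have hM0 : 0 ≤ M := le_trans (integral_nonneg fun σ => norm_nonneg _) ((hM 0).2)
  have hΛ : 0 < bigLam ε₀ := bigLam_pos (by linarith)
  set c : ℝ := 2 * fluxConst α * (bigLam ε₀)⁻¹ * M with hcdef
  have hc0' : 0 ≤ c := by have := fluxConst_nonneg α; rw [hcdef]; positivity
  -- `m ≤ c δ` for every `δ > 0`
  have hmle : ∀ δ : ℝ, 0 < δ → conveyorMass ω L n ≤ c * δ := by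
    intro δ hδ
    obtain ⟨n₁, hn₁⟩ := hfade δ hδ
    have h := conveyorMass_le_of_peak hε hc hW hU hω hL (fun k => (hM k).2) n n₁ hn₁
    calc conveyorMass ω L n ≤ 2 * fluxConst α * (bigLam ε₀)⁻¹ * δ * M := h
      _ = c * δ := by rw [hcdef]; ring
  have hm : conveyorMass ω L n = 0 := by
    refine le_antisymm ?_ hm0
    by_contra hpos
    push Not at hpos
    -- take `δ` with `c δ < m`
    have h1 := hmle (conveyorMass ω L n / (c + 1)) (div_pos hpos (by linarith))
    have h2 : c * (conveyorMass ω L n / (c + 1)) < conveyorMass ω L n := by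
      rw [mul_div_assoc', div_lt_iff₀ (by linarith : (0 : ℝ) < c + 1)]
      nlinarith
    linarith
  unfold conveyorMass at hm
  linarith

end Summit.NavierStokesRegularity.NavierStokesRegularity.Cruxes.EternalInviscidRate.FinalWakeLedger

end
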